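import Mathlib.NumberTheory.Chebyshev
import Literature.NumberTheory.LFunctions.GRHChebyshevPsiLowerBound
import HarnessLib

/-!
# A lower bound for the number of prime ideals under GRH, uniform in the field

Topic `Literature/NumberTheory/LFunctions` (namespace `Literature.NumberTheory.LFunctions.NumberField`,
next to `PrimeIdealPsi.lean`, `PrimeIdealCountDegreeOne.lean`). Everything here is PROVED; there are
no named facts; ERH for the field is an explicit hypothesis.

From the GRH-conditional Chebyshev bound `ψ_K(x) ≥ x/2 − C√x log x (log|d_K| + n_K)`
(`chebyshevPsiIdeal_ge_of_erh`, `GRHChebyshevPsiLowerBound.lean`) and the elementary passages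
`ψ_K − θ_K ≤ π_K(√x) log x` (`chebyshevPsiIdeal_sub_chebyshevThetaIdeal_le`), `π_K(y) ≤ 2 n_K y`,
`θ_K(x) ≤ π_K(x) log x`, we get

* `primeIdealCount_ge_of_erh` — under ERH for `K`, for real `x ≥ 2`,
  `π_K(x) ≥ x/(2 log x) − (C + 2)(log|d_K| + n_K) √x`  (`C = grhPsiConst`).

This is the lower half, with main term `x/(2 log x)` instead of `Li(x)`, of the effective prime
ideal theorem under GRH (Lagarias–Odlyzko 1977, Thm. 1.1; Serre 1981, Thm. 4), enough for density
lower bounds such as Bürgisser 2000 TCS, Cor. 4.8/Thm. 4.1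
(`Literature/Computability/AlgebraicComplexity/BurgisserRootCountGRHWeak.lean`). We also record
Chebyshev's explicit upper bound `π(x) ≤ 5x/log x` (`primeCounting_le_five_mul_div_log`, from
Mathlib's `Chebyshev.pi_le_log4_mul_div`).

## References

* J. C. Lagarias, A. M. Odlyzko, *Effective versions of the Chebotarev density theorem* (1977),
  Thm. 1.1 (`LagariasOdlyzko1977`).
* E. Landau, *Neuer Beweis des Primzahlsatzes und Beweis des Primidealsatzes*, Math. Ann. 56
  (1903), §§12–13 (`LandauMathAnn1903`).
-/

noncomputable section

open Finset Real
open scoped NumberField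

namespace Literature.NumberTheory.LFunctions.NumberField

variable (K : Type*) [Field K] [NumberField K]

/-! ### Elementary counting -/

/-- `π_K(y) = π_K(⌊y⌋)` for `y ≥ 0` (norms are integers). [folklore] -/
theorem primeIdealCount_eq_floor {y : ℝ} (hy : 0 ≤ y) :
    primeIdealCount K y = primeIdealCount K (⌊y⌋₊ : ℝ) := by
  unfold primeIdealCount primeIdealsLE
  congr 1
  ext P
  simp only [Set.mem_setOf_eq]
  rw [Nat.cast_le, Nat.le_floor_iff hy]

/-- **`π_K(m) ≤ 2 [K:ℚ] m`** for natural `m`: prime ideals of prime norm are `≤ [K:ℚ]` per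
rational prime (`idealNormCount_prime_le_finrank`), those of non-prime norm at most `[K:ℚ] π(√m)`
(`primeIdealCount_le_sum_idealNormCount_add`). [folklore] -/
theorem primeIdealCount_natCast_le (m : ℕ) : primeIdealCount K m ≤ 2 * Module.finrank ℚ K * m := by
  have h := primeIdealCount_le_sum_idealNormCount_add K m
  have h1 : ∑ p ∈ (range (m + 1)).filter Nat.Prime, idealNormCount K p ≤
      Module.finrank ℚ K * m := by
    calc ∑ p ∈ (range (m + 1)).filter Nat.Prime, idealNormCount K p
        ≤ ∑ p ∈ (range (m + 1)).filter Nat.Prime, Module.finrank ℚ K :=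
          sum_le_sum fun p hp => idealNormCount_prime_le_finrank K (mem_filter.mp hp).2
      _ = ((range (m + 1)).filter Nat.Prime).card * Module.finrank ℚ K := by
          rw [sum_const, smul_eq_mul]
      _ ≤ m * Module.finrank ℚ K := by
          refine Nat.mul_le_mul_right _ ?_
          calc ((range (m + 1)).filter Nat.Prime).card ≤ ((range (m + 1)).erase 0).card := by
                refine card_le_card fun p hp => ?_
                rw [mem_filter] at hp
                exact mem_erase.mpr ⟨hp.2.ne_zero, hp.1⟩
            _ = m := by rw [card_erase_of_mem (by simp), card_range]; rfl
      _ = Module.finrank ℚ K * m := mul_comm _ _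
  have h2 : Nat.primeCounting (Nat.sqrt m) ≤ m := by
    calc Nat.primeCounting (Nat.sqrt m) ≤ Nat.sqrt m := by
          rw [Nat.primeCounting, Nat.primeCounting', Nat.count_eq_card_filter_range]
          calc ((range (Nat.sqrt m + 1)).filter Nat.Prime).card
              ≤ ((range (Nat.sqrt m + 1)).erase 0).card := by
                refine card_le_card fun p hp => ?_
                rw [mem_filter] at hp
                exact mem_erase.mpr ⟨hp.2.ne_zero, hp.1⟩
            _ = Nat.sqrt m := by rw [card_erase_of_mem (by simp), card_range]; rfl
      _ ≤ m := Nat.sqrt_le_self m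
  calc primeIdealCount K m ≤ Module.finrank ℚ K * m + Module.finrank ℚ K * m :=
        h.trans (Nat.add_le_add h1 (Nat.mul_le_mul_left _ h2))
    _ = 2 * Module.finrank ℚ K * m := by ring

/-- `π_K(y) ≤ 2 [K:ℚ] y` for real `y ≥ 0`. [folklore] -/
theorem primeIdealCount_le_two_mul_finrank_mul {y : ℝ} (hy : 0 ≤ y) :
    (primeIdealCount K y : ℝ) ≤ 2 * Module.finrank ℚ K * y := by
  rw [primeIdealCount_eq_floor K hy]
  calc (primeIdealCount K (⌊y⌋₊ : ℝ) : ℝ) ≤ ((2 * Module.finrank ℚ K * ⌊y⌋₊ : ℕ) : ℝ) := by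
        exact_mod_cast primeIdealCount_natCast_le K ⌊y⌋₊
    _ = 2 * Module.finrank ℚ K * (⌊y⌋₊ : ℝ) := by push_cast; ring
    _ ≤ 2 * Module.finrank ℚ K * y := by
        gcongr
        exact Nat.floor_le hy

/-- **`θ_K(x) ≤ π_K(x) log x`** for `x ≥ 1` (each `log N𝔭 ≤ log x`). [folklore] -/
theorem chebyshevThetaIdeal_le_primeIdealCount_mul_log {x : ℝ} (hx : 1 ≤ x) :
    chebyshevThetaIdeal K x ≤ primeIdealCount K x * Real.log x := by
  have hx0 : 0 ≤ x := by linarith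
  rw [chebyshevThetaIdeal_eq_sum_primeIdealsLE K hx0, primeIdealCount,
    Set.ncard_eq_toFinset_card _ (finite_primeIdealsLE K x)]
  calc ∑ P ∈ (finite_primeIdealsLE K x).toFinset, Real.log (Ideal.absNorm P : ℝ)
      ≤ ∑ P ∈ (finite_primeIdealsLE K x).toFinset, Real.log x := by
        refine sum_le_sum fun P hP => ?_
        rw [mem_primeIdealsLE_toFinset] at hP
        have h2 := two_le_absNorm_of_isPrime hP.1 hP.2.1
        exact Real.log_le_log (by exact_mod_cast (by omega : 0 < Ideal.absNorm P)) hP.2.2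
    _ = ((finite_primeIdealsLE K x).toFinset.card : ℝ) * Real.log x := by
        rw [sum_const, nsmul_eq_mul]

/-! ### The lower bound for `π_K` under ERH -/

variable {K} in
/-- **The number of prime ideals under GRH, from below, uniformly in the field** (lower half of
Lagarias–Odlyzko 1977, Thm. 1.1, with main term `x/(2 log x)`): if `ζ_K` satisfies the Riemann
hypothesis then for every real `x ≥ 2`,
`π_K(x) ≥ x/(2 log x) − (C + 2)(log|d_K| + n_K) √x`, `C = grhPsiConst` absolute.
Proof: `π_K(x) log x ≥ θ_K(x) ≥ ψ_K(x) − π_K(√x) log x ≥ ψ_K(x) − 2 n_K √x log x` and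
`chebyshevPsiIdeal_ge_of_erh`. [cite: LagariasOdlyzko1977, Thm. 1.1] -/
theorem primeIdealCount_ge_of_erh (hERH : NumberField.ExtendedRiemannHypothesis K) {x : ℝ}
    (hx : 2 ≤ x) :
    x / (2 * Real.log x) - (grhPsiConst + 2) *
        (Real.log ((NumberField.discr K).natAbs : ℝ) + Module.finrank ℚ K) * Real.sqrt x ≤
      primeIdealCount K x := by
  have hx1 : 1 ≤ x := by linarith
  have hx0 : 0 < x := by linarith
  have hlog : 0 < Real.log x := Real.log_pos (by linarith)
  set D : ℝ := Real.log ((NumberField.discr K).natAbs : ℝ) + Module.finrank ℚ K with hD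
  set n : ℝ := (Module.finrank ℚ K : ℝ) with hn
  have hn0 : 0 ≤ n := Nat.cast_nonneg _
  have hDn : n ≤ D := by
    have : 0 ≤ Real.log ((NumberField.discr K).natAbs : ℝ) := Real.log_natCast_nonneg _
    rw [hD]; linarith
  have hψ := chebyshevPsiIdeal_ge_of_erh hERH hx
  rw [← hD] at hψ
  have hθψ := chebyshevPsiIdeal_sub_chebyshevThetaIdeal_le K hx1
  have hπsqrt : (primeIdealCount K (Real.sqrt x) : ℝ) ≤ 2 * n * Real.sqrt x :=
    primeIdealCount_le_two_mul_finrank_mul K (Real.sqrt_nonneg x)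
  have hθπ := chebyshevThetaIdeal_le_primeIdealCount_mul_log K hx1
  have hs0 : 0 ≤ Real.sqrt x := Real.sqrt_nonneg x
  have hC := grhPsiConst_pos
  -- `π_K log x ≥ x/2 − (C D + 2 n) √x log x`
  have h1 : x / 2 - (grhPsiConst * D + 2 * n) * Real.sqrt x * Real.log x ≤
      primeIdealCount K x * Real.log x := by
    have e1 : (primeIdealCount K (Real.sqrt x) : ℝ) * Real.log x ≤ 2 * n * Real.sqrt x * Real.log x :=
      mul_le_mul_of_nonneg_right hπsqrt hlog.le
    nlinarith
  have h2 : (grhPsiConst * D + 2 * n) ≤ (grhPsiConst + 2) * D := by nlinarith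
  have h3 : x / 2 - (grhPsiConst + 2) * D * Real.sqrt x * Real.log x ≤
      primeIdealCount K x * Real.log x := by
    have := mul_le_mul_of_nonneg_right h2 (mul_nonneg hs0 hlog.le)
    nlinarith
  have h4 : (x / 2 - (grhPsiConst + 2) * D * Real.sqrt x * Real.log x) / Real.log x ≤
      primeIdealCount K x := (div_le_iff₀ hlog).mpr h3
  have h5 : (x / 2 - (grhPsiConst + 2) * D * Real.sqrt x * Real.log x) / Real.log x =
      x / (2 * Real.log x) - (grhPsiConst + 2) * D * Real.sqrt x := by
    field_simp
  rw [h5] at h4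
  linarith

/-! ### Chebyshev's explicit upper bound for `π` -/

/-- **Chebyshev's upper bound, explicit**: `π(t) ≤ 5 t / log t` for real `t ≥ 2` (from Mathlib's
`Chebyshev.pi_le_log4_mul_div`: `π(t) ≤ (log 4) t/log √t + √t`, with `√t ≤ 2t/log t` and
`2 log 4 + 2 ≤ 5`). [folklore] -/
theorem primeCounting_le_five_mul_div_log {t : ℝ} (ht : 2 ≤ t) :
    (Nat.primeCounting ⌊t⌋₊ : ℝ) ≤ 5 * t / Real.log t := by
  have ht0 : 0 < t := by linarith
  have hlt : 0 < Real.log t := Real.log_pos (by linarith)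
  have h := Chebyshev.pi_le_log4_mul_div (show (1 : ℝ) < t by linarith)
  have hsqrt : Real.log (Real.sqrt t) = Real.log t / 2 := by rw [Real.log_sqrt ht0.le]
  rw [hsqrt] at h
  have hs : Real.sqrt t ≤ 2 * t / Real.log t := by
    rw [le_div_iff₀ hlt]
    have h1 : Real.log t ≤ t ^ (1 / 2 : ℝ) / (1 / 2) := Real.log_le_rpow_div ht0.le (by norm_num)
    rw [← Real.sqrt_eq_rpow] at h1
    have hst : Real.sqrt t * Real.sqrt t = t := Real.mul_self_sqrt ht0.le
    have hs0 : 0 ≤ Real.sqrt t := Real.sqrt_nonneg t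
    nlinarith
  have hlog4 : Real.log 4 ≤ 3 / 2 := by
    have : Real.log 4 = 2 * Real.log 2 := by
      rw [show (4 : ℝ) = 2 ^ 2 by norm_num, Real.log_pow]; norm_num
    rw [this]; have := Real.log_two_lt_d9; linarith
  calc (Nat.primeCounting ⌊t⌋₊ : ℝ) ≤ Real.log 4 * t / (Real.log t / 2) + Real.sqrt t := h
    _ ≤ Real.log 4 * t / (Real.log t / 2) + 2 * t / Real.log t := by linarith
    _ = (2 * Real.log 4 + 2) * t / Real.log t := by field_simp
    _ ≤ 5 * t / Real.log t := by
        refine div_le_div_of_nonneg_right ?_ hlt.le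
        nlinarith

end Literature.NumberTheory.LFunctions.NumberField

end
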